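import Mathlib
import Literature.AlgebraicGeometry.Resolution.PointBlowupFlagInvariant

/-!
# `WeightedInvariant.LocalWeightedDrop`, line `hasse-ridge-face-selection`, S3ρ sub-stub S3ρD `stub_wildMonicSurfaceDescent`: item D-0
# «a maximising flag exists» — the ORDER-THEORETIC SKELETON of Perlega's Prop. 7.4.10 (D-0b of stub-3's D0-SPEC)

Crux item stmt-ResolutionOfSingularities-8899 `LocalWeightedDrop` (route `ResolutionOfSingularities/WeightedInvariant`), engine of the door
`HypersurfaceCentreConstruction` stmt-ResolutionOfSingularities-19897.  [OURS · L1 W4.3, chain w43, res-L1-w43-stub-3 (gen 3) on roadmap item D-0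
of `L/res-L1-w43-stub-7/S3RHOD-ROADMAP.md` under the S3ρ owners res-type-083 / stub-7 (plan-1 RULINGS gen 8 #1 (iv)); spec
`L/res-L1-w43-stub-3/D0-SPEC.md` §3.  MODEL: S. Perlega, thesis Wien 2017 / arXiv:2011.14443 §7.4: Prop. 7.4.10 («There exists a valid flag 𝓕
such that for all other valid flags 𝓖 the inequality inv(𝓖) ≤ inv(𝓕) holds») «follows from» the per-class maxima (Props. 7.4.6, 7.4.9) and
the bounds of Prop. 7.4.8 («(1) d_𝓕 ≤ d_* for n_𝓕 > 0; (2) n_𝓕 ≥ N ⇒ d_𝓕 = −1»), and Lemma 7.4.11 (finite `s`, `d > 0` off the terminal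
cases).  Nothing here is a statement of H. Hironaka's manuscript; folklore order theory, OURS.]

The flag triples live in `Triple = ℕ ×ₗ ℕ ×ₗ ℕ∞` (`(d, n, s)`, lexicographic; the type of `Literature.…PointBlowupFlagInvariant` used by
stub-1's `PurePowerFlag.IsFlagTriple` and to be used by the tuple version).  For ANY family `v : Φ → Triple`:
* `exists_isGreatest_triple` — if (i) some member has `d > 0`, (ii) `d` is bounded, (iii) `d = 0` whenever `n ≥ N`, and (iv) for every
  `D > 0` and `n` the `s`-values of the members with `(d, n) = (D, n)` are either absent or have a FINITE greatest element, then the family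
  has a greatest triple, with finite `s` and `d > 0` — the shape of `AttainStatement`;
* `exists_isGreatest_triple_of_finite` — the special case «finitely many `(d, n)` classes with `d > 0`, each with an attained finite `s`»;
* small lex lemmas on `Triple` (`triple_le_iff`, `triple_lt_of_fst_lt`, …) for the case files (C6)–(C8).
-/

set_option linter.dupNamespace false -- mandated namespace of this single-conjunct summit

namespace Summit.ResolutionOfSingularities.ResolutionOfSingularities.Theorems

namespace WildMonic

open Literature.AlgebraicGeometry.Resolution
open Literature.AlgebraicGeometry.Resolution.HauserPerlega2024 (Triple)

/-! ### Lexicographic bookkeeping on `Triple = ℕ ×ₗ ℕ ×ₗ ℕ∞` -/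

/-- The triple with components `(d, n, s)`. -/
theorem ofLex_toLex_triple (d n : ℕ) (s : ℕ∞) :
    (ofLex (toLex (d, toLex (n, s)) : Triple)).1 = d ∧ (ofLex (ofLex (toLex (d, toLex (n, s)) : Triple)).2).1 = n ∧
      (ofLex (ofLex (toLex (d, toLex (n, s)) : Triple)).2).2 = s := ⟨rfl, rfl, rfl⟩

/-- A triple is determined by its three components. -/
theorem triple_eq (v : Triple) : v = toLex ((ofLex v).1, toLex ((ofLex (ofLex v).2).1, (ofLex (ofLex v).2).2)) := rfl

/-- A smaller first component makes a smaller triple. -/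
theorem triple_lt_of_fst_lt {v w : Triple} (h : (ofLex v).1 < (ofLex w).1) : v < w := by
  rw [triple_eq v, triple_eq w]
  exact Prod.Lex.toLex_lt_toLex.mpr (Or.inl h)

/-- Equal first and a smaller second component make a smaller triple. -/
theorem triple_lt_of_snd_lt {v w : Triple} (h1 : (ofLex v).1 = (ofLex w).1) (h2 : (ofLex (ofLex v).2).1 < (ofLex (ofLex w).2).1) :
    v < w := by
  rw [triple_eq v, triple_eq w, h1]
  exact Prod.Lex.toLex_lt_toLex.mpr (Or.inr ⟨rfl, Prod.Lex.toLex_lt_toLex.mpr (Or.inl h2)⟩)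

/-- Equal first two components and `≤` on the third make `≤`. -/
theorem triple_le_of_thd_le {v w : Triple} (h1 : (ofLex v).1 = (ofLex w).1) (h2 : (ofLex (ofLex v).2).1 = (ofLex (ofLex w).2).1)
    (h3 : (ofLex (ofLex v).2).2 ≤ (ofLex (ofLex w).2).2) : v ≤ w := by
  rw [triple_eq v, triple_eq w, h1, h2]
  exact Prod.Lex.toLex_le_toLex.mpr (Or.inr ⟨rfl, Prod.Lex.toLex_le_toLex.mpr (Or.inr ⟨rfl, h3⟩)⟩)

/-- The first component is monotone. -/
theorem fst_le_of_triple_le {v w : Triple} (h : v ≤ w) : (ofLex v).1 ≤ (ofLex w).1 := by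
  rw [triple_eq v, triple_eq w] at h
  rcases Prod.Lex.toLex_le_toLex.mp h with h | ⟨h, -⟩
  · exact h.le
  · exact h.le

/-- With equal first components the second component is monotone. -/
theorem snd_le_of_triple_le {v w : Triple} (h : v ≤ w) (h1 : (ofLex v).1 = (ofLex w).1) :
    (ofLex (ofLex v).2).1 ≤ (ofLex (ofLex w).2).1 := by
  rw [triple_eq v, triple_eq w] at h
  rcases Prod.Lex.toLex_le_toLex.mp h with h | ⟨-, h⟩
  · exact absurd h1 h.ne
  · rcases Prod.Lex.toLex_le_toLex.mp h with h | ⟨h, -⟩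
    · exact h.le
    · exact h.le

/-- With equal first two components the third component is monotone. -/
theorem thd_le_of_triple_le {v w : Triple} (h : v ≤ w) (h1 : (ofLex v).1 = (ofLex w).1)
    (h2 : (ofLex (ofLex v).2).1 = (ofLex (ofLex w).2).1) : (ofLex (ofLex v).2).2 ≤ (ofLex (ofLex w).2).2 := by
  rw [triple_eq v, triple_eq w] at h
  rcases Prod.Lex.toLex_le_toLex.mp h with h | ⟨-, h⟩
  · exact absurd h1 h.ne
  · rcases Prod.Lex.toLex_le_toLex.mp h with h | ⟨-, h⟩
    · exact absurd h2 h.ne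
    · exact h

/-! ### The skeleton of Prop. 7.4.10 -/

/-- **A GREATEST TRIPLE EXISTS** (the order-theoretic skeleton of Perlega's Prop. 7.4.10 with Lemma 7.4.11).  For a family `v : Φ → Triple`
of flag triples `(d, n, s)`: if (i) some member has `d > 0` (a transversal valid flag — Lemma 7.4.4 (1) / Prop. 7.4.5), (ii) `d` is bounded
(Prop. 7.4.8 (1) and Lemma 7.4.1), (iii) `d = 0` as soon as `n ≥ N` (Prop. 7.4.8 (2), Hauser–Perlega's `0` for Perlega's `−1`), and (iv) for every
class `(D, n)` with `D > 0` the `s`-values of its members are absent or have a FINITE GREATEST element (Props. 7.4.6 / 7.4.9 with Prop. 5.3.5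
and Lemma 7.4.11), then some member's triple is greatest, its `s` is finite and its `d` is positive.
[cite: Perlega2020, Prop. 7.4.10, Lemma 7.4.11 (arXiv:2011.14443 §7.4.3)] -/
theorem exists_isGreatest_triple {Φ : Type*} (v : Φ → Triple)
    (hpos : ∃ φ, 0 < (ofLex (v φ)).1)
    (hbd : ∃ dstar : ℕ, ∀ φ, (ofLex (v φ)).1 ≤ dstar)
    (hN : ∃ N : ℕ, ∀ φ, N ≤ (ofLex (ofLex (v φ)).2).1 → (ofLex (v φ)).1 = 0)
    (hs : ∀ D n : ℕ, 0 < D → (∃ φ, (ofLex (v φ)).1 = D ∧ (ofLex (ofLex (v φ)).2).1 = n) →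
      ∃ φ, (ofLex (v φ)).1 = D ∧ (ofLex (ofLex (v φ)).2).1 = n ∧ (ofLex (ofLex (v φ)).2).2 ≠ ⊤ ∧
        ∀ ψ, (ofLex (v ψ)).1 = D → (ofLex (ofLex (v ψ)).2).1 = n → (ofLex (ofLex (v ψ)).2).2 ≤ (ofLex (ofLex (v φ)).2).2) :
    ∃ φ, (∀ ψ, v ψ ≤ v φ) ∧ (ofLex (ofLex (v φ)).2).2 ≠ ⊤ ∧ 0 < (ofLex (v φ)).1 := by
  classical
  obtain ⟨dstar, hdstar⟩ := hbd
  obtain ⟨N, hNd⟩ := hN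
  -- the largest first component `D`
  let dset : Finset ℕ := (Finset.range (dstar + 1)).filter fun D => ∃ φ, (ofLex (v φ)).1 = D
  have hdmem : ∀ φ, (ofLex (v φ)).1 ∈ dset := fun φ =>
    Finset.mem_filter.mpr ⟨Finset.mem_range.mpr (Nat.lt_succ_of_le (hdstar φ)), φ, rfl⟩
  obtain ⟨φ₀, hφ₀⟩ := hpos
  have hdne : dset.Nonempty := ⟨_, hdmem φ₀⟩
  set D := dset.max' hdne with hD
  obtain ⟨φD, hφD⟩ : ∃ φ, (ofLex (v φ)).1 = D := (Finset.mem_filter.mp (Finset.max'_mem dset hdne)).2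
  have hDle : ∀ ψ, (ofLex (v ψ)).1 ≤ D := fun ψ => Finset.le_max' dset _ (hdmem ψ)
  have hDpos : 0 < D := lt_of_lt_of_le hφ₀ (hDle φ₀)
  -- in the class `d = D` the second component is `< N`
  have hnlt : ∀ ψ, (ofLex (v ψ)).1 = D → (ofLex (ofLex (v ψ)).2).1 < N := by
    intro ψ hψ
    by_contra hge
    have := hNd ψ (not_lt.mp hge)
    omega
  -- the largest second component `n₀` in the class `d = D`
  let nset : Finset ℕ := (Finset.range N).filter fun n => ∃ φ, (ofLex (v φ)).1 = D ∧ (ofLex (ofLex (v φ)).2).1 = n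
  have hnmem : ∀ ψ, (ofLex (v ψ)).1 = D → (ofLex (ofLex (v ψ)).2).1 ∈ nset := fun ψ hψ =>
    Finset.mem_filter.mpr ⟨Finset.mem_range.mpr (hnlt ψ hψ), ψ, hψ, rfl⟩
  have hnne : nset.Nonempty := ⟨_, hnmem φD hφD⟩
  set n₀ := nset.max' hnne with hn₀
  obtain ⟨φn, hφn1, hφn2⟩ : ∃ φ, (ofLex (v φ)).1 = D ∧ (ofLex (ofLex (v φ)).2).1 = n₀ :=
    (Finset.mem_filter.mp (Finset.max'_mem nset hnne)).2
  have hnle : ∀ ψ, (ofLex (v ψ)).1 = D → (ofLex (ofLex (v ψ)).2).1 ≤ n₀ := fun ψ hψ => Finset.le_max' nset _ (hnmem ψ hψ)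
  -- the greatest `s` in the class `(D, n₀)`
  obtain ⟨φ, hφ1, hφ2, hφs, hφmax⟩ := hs D n₀ hDpos ⟨φn, hφn1, hφn2⟩
  refine ⟨φ, fun ψ => ?_, hφs, by rw [hφ1]; exact hDpos⟩
  -- comparison
  rcases (hDle ψ).lt_or_eq with hlt | heq
  · exact (triple_lt_of_fst_lt (by rw [hφ1]; exact hlt)).le
  rcases (hnle ψ heq).lt_or_eq with hlt2 | heq2
  · exact (triple_lt_of_snd_lt (by rw [heq, hφ1]) (by rw [hφ2]; exact hlt2)).le
  exact triple_le_of_thd_le (by rw [heq, hφ1]) (by rw [heq2, hφ2]) (hφmax ψ heq heq2)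

/-- **THE FINITE-CANDIDATES FORM** (stub-1's pattern for the pure case): if the classes `(d, n)` with `d > 0` are finitely many (`d ≤ d*`,
and `n < N` whenever `d > 0`), each non-empty class with `d > 0` has a member with greatest finite `s`, and some member has `d > 0`, then
a greatest triple exists, with finite `s` and `d > 0`. [cite: Perlega2020, Prop. 7.4.10 (arXiv:2011.14443 §7.4.3)] -/
theorem exists_isGreatest_triple_of_finite {Φ : Type*} (v : Φ → Triple)
    (hpos : ∃ φ, 0 < (ofLex (v φ)).1)
    (hbd : ∃ dstar : ℕ, ∀ φ, (ofLex (v φ)).1 ≤ dstar)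
    (hN : ∃ N : ℕ, ∀ φ, 0 < (ofLex (v φ)).1 → (ofLex (ofLex (v φ)).2).1 < N)
    (hs : ∀ D n : ℕ, 0 < D → (∃ φ, (ofLex (v φ)).1 = D ∧ (ofLex (ofLex (v φ)).2).1 = n) →
      ∃ φ, (ofLex (v φ)).1 = D ∧ (ofLex (ofLex (v φ)).2).1 = n ∧ (ofLex (ofLex (v φ)).2).2 ≠ ⊤ ∧
        ∀ ψ, (ofLex (v ψ)).1 = D → (ofLex (ofLex (v ψ)).2).1 = n → (ofLex (ofLex (v ψ)).2).2 ≤ (ofLex (ofLex (v φ)).2).2) :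
    ∃ φ, (∀ ψ, v ψ ≤ v φ) ∧ (ofLex (ofLex (v φ)).2).2 ≠ ⊤ ∧ 0 < (ofLex (v φ)).1 := by
  obtain ⟨N, hN'⟩ := hN
  refine exists_isGreatest_triple v hpos hbd ⟨N, fun φ hle => ?_⟩ hs
  by_contra hne
  exact absurd (hN' φ (Nat.pos_of_ne_zero hne)) (not_lt.mpr hle)

/-- Packaging as `IsGreatest` on the set of values. -/
theorem isGreatest_range_of_forall_le {Φ : Type*} (v : Φ → Triple) {φ : Φ} (h : ∀ ψ, v ψ ≤ v φ) :
    IsGreatest (Set.range v) (v φ) :=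
  ⟨⟨φ, rfl⟩, by rintro _ ⟨ψ, rfl⟩; exact h ψ⟩

/-! ### Attainment is only needed in the top class -/

/-- **THE TOP-CLASS FORM** of `exists_isGreatest_triple`: hypothesis (iv) is only used in the LEX-GREATEST class `(D, n₀)` (`D` the largest
first component, `n₀` the largest second component among triples with first component `D`), so it suffices to assume `s`-attainment for
classes that are maximal in this sense — the form Perlega's Prop. 5.3.5 actually delivers (its hypothesis «`f` is `ord`-clean with respect
to `J₋₁`» says the class has the maximal `d`). [cite: Perlega2020, Prop. 7.4.10, Lemma 7.4.11, Prop. 5.3.5 (arXiv:2011.14443 §7.4.3, §5.3)] -/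
theorem exists_isGreatest_triple_top {Φ : Type*} (v : Φ → Triple)
    (hpos : ∃ φ, 0 < (ofLex (v φ)).1)
    (hbd : ∃ dstar : ℕ, ∀ φ, (ofLex (v φ)).1 ≤ dstar)
    (hN : ∃ N : ℕ, ∀ φ, N ≤ (ofLex (ofLex (v φ)).2).1 → (ofLex (v φ)).1 = 0)
    (hs : ∀ D n : ℕ, 0 < D → (∃ φ, (ofLex (v φ)).1 = D ∧ (ofLex (ofLex (v φ)).2).1 = n) →
      (∀ ψ, (ofLex (v ψ)).1 ≤ D) → (∀ ψ, (ofLex (v ψ)).1 = D → (ofLex (ofLex (v ψ)).2).1 ≤ n) →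
      ∃ φ, (ofLex (v φ)).1 = D ∧ (ofLex (ofLex (v φ)).2).1 = n ∧ (ofLex (ofLex (v φ)).2).2 ≠ ⊤ ∧
        ∀ ψ, (ofLex (v ψ)).1 = D → (ofLex (ofLex (v ψ)).2).1 = n → (ofLex (ofLex (v ψ)).2).2 ≤ (ofLex (ofLex (v φ)).2).2) :
    ∃ φ, (∀ ψ, v ψ ≤ v φ) ∧ (ofLex (ofLex (v φ)).2).2 ≠ ⊤ ∧ 0 < (ofLex (v φ)).1 := by
  classical
  obtain ⟨dstar, hdstar⟩ := hbd
  obtain ⟨N, hNd⟩ := hN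
  let dset : Finset ℕ := (Finset.range (dstar + 1)).filter fun D => ∃ φ, (ofLex (v φ)).1 = D
  have hdmem : ∀ φ, (ofLex (v φ)).1 ∈ dset := fun φ =>
    Finset.mem_filter.mpr ⟨Finset.mem_range.mpr (Nat.lt_succ_of_le (hdstar φ)), φ, rfl⟩
  obtain ⟨φ₀, hφ₀⟩ := hpos
  have hdne : dset.Nonempty := ⟨_, hdmem φ₀⟩
  set D := dset.max' hdne with hD
  obtain ⟨φD, hφD⟩ : ∃ φ, (ofLex (v φ)).1 = D := (Finset.mem_filter.mp (Finset.max'_mem dset hdne)).2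
  have hDle : ∀ ψ, (ofLex (v ψ)).1 ≤ D := fun ψ => Finset.le_max' dset _ (hdmem ψ)
  have hDpos : 0 < D := lt_of_lt_of_le hφ₀ (hDle φ₀)
  have hnlt : ∀ ψ, (ofLex (v ψ)).1 = D → (ofLex (ofLex (v ψ)).2).1 < N := by
    intro ψ hψ
    by_contra hge
    have := hNd ψ (not_lt.mp hge)
    omega
  let nset : Finset ℕ := (Finset.range N).filter fun n => ∃ φ, (ofLex (v φ)).1 = D ∧ (ofLex (ofLex (v φ)).2).1 = n
  have hnmem : ∀ ψ, (ofLex (v ψ)).1 = D → (ofLex (ofLex (v ψ)).2).1 ∈ nset := fun ψ hψ =>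
    Finset.mem_filter.mpr ⟨Finset.mem_range.mpr (hnlt ψ hψ), ψ, hψ, rfl⟩
  have hnne : nset.Nonempty := ⟨_, hnmem φD hφD⟩
  set n₀ := nset.max' hnne with hn₀
  obtain ⟨φn, hφn1, hφn2⟩ : ∃ φ, (ofLex (v φ)).1 = D ∧ (ofLex (ofLex (v φ)).2).1 = n₀ :=
    (Finset.mem_filter.mp (Finset.max'_mem nset hnne)).2
  have hnle : ∀ ψ, (ofLex (v ψ)).1 = D → (ofLex (ofLex (v ψ)).2).1 ≤ n₀ := fun ψ hψ => Finset.le_max' nset _ (hnmem ψ hψ)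
  obtain ⟨φ, hφ1, hφ2, hφs, hφmax⟩ := hs D n₀ hDpos ⟨φn, hφn1, hφn2⟩ hDle hnle
  refine ⟨φ, fun ψ => ?_, hφs, by rw [hφ1]; exact hDpos⟩
  rcases (hDle ψ).lt_or_eq with hlt | heq
  · exact (triple_lt_of_fst_lt (by rw [hφ1]; exact hlt)).le
  rcases (hnle ψ heq).lt_or_eq with hlt2 | heq2
  · exact (triple_lt_of_snd_lt (by rw [heq, hφ1]) (by rw [hφ2]; exact hlt2)).le
  exact triple_le_of_thd_le (by rw [heq, hφ1]) (by rw [heq2, hφ2]) (hφmax ψ heq heq2)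

end WildMonic

end Summit.ResolutionOfSingularities.ResolutionOfSingularities.Theorems
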